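import Mathlib
import HarnessLib
import Summits.AtomisticToContinuum.BoseEinsteinCondensation.Theses.GapWindowLadder
import Summits.AtomisticToContinuum.BoseEinsteinCondensation.Theses.DetailResponseLadder
import Summits.AtomisticToContinuum.BoseEinsteinCondensation.Theorems.NumberPhaseSandwichLossBookkeeping

/-!
# Routes GapWindowLadder / DetailResponseLadder — shared support item `LossBookkeeping`
(stmt-AtomisticToContinuum-27067), BY NAME

decomp-a2c lens-6 g13 (B twin owed since critic rows 103/120). The item text is verbatim the
text of `Theses.NumberPhaseSandwich.LossBookkeeping` (stmt-AtomisticToContinuum-32640, PROVED by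
`Theorems.NumberPhaseSandwichLossBookkeeping.lossBookkeeping`, p773320): for every `N`, every
`L > 0`, every trial state `Ψ` and every level `k ≥ 1`, (a) the half-parent Parseval inequality
`S_k ≤ S_{k-1} + 16⁻¹ Σ_c Σ_{c' ≠ c sibling} dip(c,c')` and (b) `dip(c,c') ≤ 2(n_c + n_{c'})`.
Both route decls are closed here by the tree theorem (definitional unfolding, no new mathematics).
-/

namespace Summit.AtomisticToContinuum.BoseEinsteinCondensation.Theorems.GapWindowLadderLossBookkeeping

/-- **`LossBookkeeping` holds** for route GapWindowLadder (item stmt-AtomisticToContinuum-27067):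
the tree theorem `NumberPhaseSandwichLossBookkeeping.lossBookkeeping`, read on the identical text. -/
theorem lossBookkeeping :
    Summit.AtomisticToContinuum.BoseEinsteinCondensation.Theses.GapWindowLadder.LossBookkeeping :=
  Summit.AtomisticToContinuum.BoseEinsteinCondensation.Theorems.NumberPhaseSandwichLossBookkeeping.lossBookkeeping

/-- **`LossBookkeeping` holds** for route DetailResponseLadder (the same shared item
stmt-AtomisticToContinuum-27067, parent route of GapWindowLadder). -/
theorem lossBookkeeping_detailResponseLadder :
    Summit.AtomisticToContinuum.BoseEinsteinCondensation.Theses.DetailResponseLadder.LossBookkeeping :=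
  Summit.AtomisticToContinuum.BoseEinsteinCondensation.Theorems.NumberPhaseSandwichLossBookkeeping.lossBookkeeping

end Summit.AtomisticToContinuum.BoseEinsteinCondensation.Theorems.GapWindowLadderLossBookkeeping
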